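import Literature.AlgebraicGeometry.KTheory.GrothendieckGroupProduct
import Literature.AlgebraicGeometry.Modules.TensorAssociator
import HarnessLib

/-!
# Associativity of the product on `K₀(X)` and of its action on `K(X)` (Görtz–Wedhorn II Def. 23.52)

Layer `Literature/AlgebraicGeometry/KTheory` (0 definitions, 0 named facts, no instances, no notation). ERRATUM to the
module docstrings of `KTheory/GrothendieckGroupProduct` and `KTheory/CoherentGrothendieckGroupModule`, which say
«NOT HERE: associativity … (needs the associator `(M ⊗ N) ⊗ P ≅ M ⊗ (N ⊗ P)` of `tensorObj`, which the tree does not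
construct)»: that sentence is WRONG about the tree — the associator is `Modules/TensorAssociator.tensorAssoc L M N :
(L ⊗ M) ⊗ N ≅ L ⊗ (M ⊗ N)` (The Stacks Project, Tag 01CA, Lemma 17.16.1; with naturality `tensorAssoc_naturality`;
proved there through "sheafification is monoidal"). With it (this file, everything proved):

* `KZero.mulHom_mulHom_of_of_of`, **`KZero.mulHom_assoc : (x · y) · z = x · (y · z)`** — the product
  `[E] · [E′] = [E ⊗ E′]` on `K₀(X)` (`KTheory/GrothendieckGroupProduct.mulHom`) is associative (Görtz–Wedhorn II
  Def. 23.52 (1): "clearly associative and commutative"; commutativity and unit are in that file), `mulHom_left_comm`,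
  `mulHom_right_comm`;
* `KZero.smulHom_mulHom_of_of_of`, **`KZero.smulHom_mulHom : (x · y) • w = x • (y • w)`** — the biadditive action
  `[E] • [F] = [E ⊗ F]` of `K₀(X)` on `K(X)` (`KTheory/CoherentGrothendieckGroupModule.smulHom`, `X` locally
  noetherian) is a genuine module action (Def. 23.52 (2)); with `smulHom_unit` of that file these are the module axioms.

Still NO `Mul` ∕ `CommRing (KZero X)` ∕ `Module (KZero X) (KZeroCoh X)` instance is declared (typing-lane rule):
the axioms are theorems about the homomorphisms `mulHom`, `smulHom`.

## References

* U. Görtz, T. Wedhorn, *Algebraic Geometry II* (2023), Remark ∕ Def. 23.52 (1), (2) (p. 437). [GortzWedhorn2023]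
* W. Fulton, *Intersection Theory*, 2nd ed. (1998), §15.1 (p. 281). [Fulton1998]
* The Stacks Project, Tag 01CA (Modules, Lemma 17.16.1: the associator). [StacksProject]
-/

noncomputable section

universe u

open CategoryTheory CategoryTheory.Limits AlgebraicGeometry
open Literature.AlgebraicGeometry.Motives Literature.AlgebraicGeometry.Morphisms
  Literature.AlgebraicGeometry.Modules

namespace Literature.AlgebraicGeometry.KTheory

variable {X : Scheme.{u}}

namespace KZero

/-- **`([E] · [E′]) · [E″] = [E] · ([E′] · [E″])` on generators** (the associator `(E ⊗ E′) ⊗ E″ ≅ E ⊗ (E′ ⊗ E″)`,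
`Modules/TensorAssociator.tensorAssoc`). [cite: GortzWedhorn2023, Remark and Def. 23.52 (1) (p. 437)] [cite: StacksProject, Tag 01CA (Lemma 17.16.1)] -/
theorem mulHom_mulHom_of_of_of {E E' E'' : X.Modules} (hE : IsFiniteLocallyFree E) (hE' : IsFiniteLocallyFree E')
    (hE'' : IsFiniteLocallyFree E'') :
    mulHom (mulHom (KZero.of E hE) (KZero.of E' hE')) (KZero.of E'' hE'') =
      mulHom (KZero.of E hE) (mulHom (KZero.of E' hE') (KZero.of E'' hE'')) := by
  rw [mulHom_of_of hE hE' (isFiniteLocallyFree_tensorObj E E' hE hE'),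
    mulHom_of_of _ hE'' (isFiniteLocallyFree_tensorObj _ _ (isFiniteLocallyFree_tensorObj E E' hE hE') hE''),
    mulHom_of_of hE' hE'' (isFiniteLocallyFree_tensorObj E' E'' hE' hE''),
    mulHom_of_of hE _ (isFiniteLocallyFree_tensorObj _ _ hE (isFiniteLocallyFree_tensorObj E' E'' hE' hE''))]
  exact KZero.of_iso (tensorAssoc E E' E'') _ _

/-- **The product on `K₀(X)` is associative**: `(x · y) · z = x · (y · z)` ("clearly associative and commutative").
[cite: GortzWedhorn2023, Remark and Def. 23.52 (1) (p. 437)] -/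
theorem mulHom_assoc (x y z : KZero X) : mulHom (mulHom x y) z = mulHom x (mulHom y z) := by
  suffices h : ∀ x y : KZero X, mulHom (mulHom x y) = (mulHom x).comp (mulHom y) from
    DFunLike.congr_fun (h x y) z
  intro x y
  induction x using KZero.induction_on with
  | zero => simp only [map_zero, AddMonoidHom.zero_apply, AddMonoidHom.zero_comp]
  | of E hE =>
    induction y using KZero.induction_on with
    | zero => simp only [map_zero, AddMonoidHom.comp_zero]
    | of E' hE' =>
      refine KZero.hom_ext fun E'' hE'' ↦ ?_
      rw [AddMonoidHom.comp_apply]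
      exact mulHom_mulHom_of_of_of hE hE' hE''
    | neg y hy => simp only [map_neg, AddMonoidHom.comp_neg, hy]
    | add y y' hy hy' => simp only [map_add, AddMonoidHom.comp_add, hy, hy']
  | neg x hx => simp only [map_neg, AddMonoidHom.neg_apply, AddMonoidHom.neg_comp, hx]
  | add x x' hx hx' => simp only [map_add, AddMonoidHom.add_apply, AddMonoidHom.add_comp, hx, hx']

/-- Left-commutativity `x · (y · z) = y · (x · z)`. [cite: GortzWedhorn2023, Remark and Def. 23.52 (1) (p. 437)] -/
theorem mulHom_left_comm (x y z : KZero X) : mulHom x (mulHom y z) = mulHom y (mulHom x z) := by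
  rw [← mulHom_assoc, mulHom_comm x y, mulHom_assoc]

/-- Right-commutativity `(x · y) · z = (x · z) · y`. [cite: GortzWedhorn2023, Remark and Def. 23.52 (1) (p. 437)] -/
theorem mulHom_right_comm (x y z : KZero X) : mulHom (mulHom x y) z = mulHom (mulHom x z) y := by
  rw [mulHom_assoc, mulHom_comm y z, ← mulHom_assoc]

/-- **`([E] · [E′]) • [F] = [E] • ([E′] • [F])` on generators** of the `K₀(X)`-action on `K(X)` (`X` locally
noetherian; the associator with a coherent right factor, `Modules/CohTensorObjLocallyFree`).
[cite: GortzWedhorn2023, Remark and Def. 23.52 (2) (p. 437)] [cite: StacksProject, Tag 01CA (Lemma 17.16.1)] -/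
theorem smulHom_mulHom_of_of_of [IsLocallyNoetherian X] {E E' F : X.Modules} (hE : IsFiniteLocallyFree E)
    (hE' : IsFiniteLocallyFree E') (hF : Coh F) :
    KZeroCoh.smulHom (mulHom (KZero.of E hE) (KZero.of E' hE')) (KZeroCoh.of F hF) =
      KZeroCoh.smulHom (KZero.of E hE) (KZeroCoh.smulHom (KZero.of E' hE') (KZeroCoh.of F hF)) := by
  rw [mulHom_of_of hE hE' (isFiniteLocallyFree_tensorObj E E' hE hE'),
    KZeroCoh.smulHom_of_of _ hF (Coh.tensorObj_of_isFiniteLocallyFree (isFiniteLocallyFree_tensorObj E E' hE hE') hF),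
    KZeroCoh.smulHom_of_of hE' hF (Coh.tensorObj_of_isFiniteLocallyFree hE' hF),
    KZeroCoh.smulHom_of_of hE _ (Coh.tensorObj_of_isFiniteLocallyFree hE (Coh.tensorObj_of_isFiniteLocallyFree hE' hF))]
  exact KZeroCoh.of_iso (tensorAssoc E E' F) _ _

/-- **`K(X)` is a genuine `K₀(X)`-module: `(x · y) • w = x • (y • w)`** (`X` locally noetherian; with
`KZeroCoh.smulHom_unit` the module axioms hold). [cite: GortzWedhorn2023, Remark and Def. 23.52 (2) (p. 437)] -/
theorem smulHom_mulHom [IsLocallyNoetherian X] (x y : KZero X) (w : KZeroCoh X) :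
    KZeroCoh.smulHom (mulHom x y) w = KZeroCoh.smulHom x (KZeroCoh.smulHom y w) := by
  suffices h : ∀ x y : KZero X, KZeroCoh.smulHom (mulHom x y) = (KZeroCoh.smulHom x).comp (KZeroCoh.smulHom y) from
    DFunLike.congr_fun (h x y) w
  intro x y
  induction x using KZero.induction_on with
  | zero => simp only [map_zero, AddMonoidHom.zero_apply, AddMonoidHom.zero_comp]
  | of E hE =>
    induction y using KZero.induction_on with
    | zero => simp only [map_zero, AddMonoidHom.comp_zero]
    | of E' hE' =>
      refine KZeroCoh.hom_ext fun F hF ↦ ?_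
      rw [AddMonoidHom.comp_apply]
      exact smulHom_mulHom_of_of_of hE hE' hF
    | neg y hy => simp only [map_neg, AddMonoidHom.comp_neg, hy]
    | add y y' hy hy' => simp only [map_add, AddMonoidHom.comp_add, hy, hy']
  | neg x hx => simp only [map_neg, AddMonoidHom.neg_apply, AddMonoidHom.neg_comp, hx]
  | add x x' hx hx' => simp only [map_add, AddMonoidHom.add_apply, AddMonoidHom.add_comp, hx, hx']

end KZero

end Literature.AlgebraicGeometry.KTheory

end
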